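/-
Copyright (c) 2026 the pub-hodgecm-mathlib formalisation cell (harness21).  Prover seat hodgecm-mathlib-K2Liu-p10 (g6), Track B «K2-LIT» ∕ hLiu418
#184♮, Road I v3, unit U5 «THE CLOSE», FACE-G letter L2 (W-orb), closure route (C2) file (C2-B-top) «THE ORBIT LAW ON PLACE-PRODUCTS FROM THE PRODUCT
LAW» (default work 00:06:45Z after ★ p863364; chair K2-lead (g2) valve; desk K2Liu-p09 (g8); box K2Liu-audit1 (g2)).  THEOREMS ONLY.  2026-09-05.
-/
import Summits.HodgeConjecture.HodgeConjecture.Theorems.K2LiuArchOrbitDerivClosureSpan        -- ★ p863327 (C2-org, span form): `thetaOrbitLetter_of_dense_span`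
import Summits.HodgeConjecture.HodgeConjecture.Theorems.K2LiuArchSchwartzPlaceProductDense     -- ★ p863267 (C2-i): `dense_span_symm_tensorPi`
import Summits.HodgeConjecture.HodgeConjecture.Theorems.K2LiuArchWeilOrbitContinuous           -- ★ p863364 (C2-iii′): `continuous_archWeilRep_dD_expGL`
import Literature.Analysis.SegalBargmann.SchwartzTensorStrongContinuity                         -- ★ `tensorOp`, `tensorOp_tensorPi`, `sumProdLeftCLM_eq_tensorPi`
import HarnessLib

/-!
# K2_Liu road (hLiu418 = stmt-HodgeConjecture-24832), FACE-G letter L2 (W-orb), route (C2): THE ORBIT LAW ON PLACE-PRODUCTS AND THE (W-orb)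
# HEAD MODULO THE PRODUCT LAW — the global operator is `A = η′ • 1 + 𝒥⁻¹ ∘ (dω_Y ⊠̂ 1) ∘ 𝒥`

Cell `pub/hodgecm-mathlib` (D-0151), Track B, build stream 29; helper lane (`--supports stmt-HodgeConjecture-24832`), count-neutral.

The (W-orb) closure organ ★ p863244 ∕ ★ p863327 (`thetaOrbitLetter_of_dense(_span)`, K2Liu-p09 (g8)) turns a derivative law `hlaw` on a set `P` of
Schwartz vectors with dense span, for ONE global continuous ℂ-linear operator `A` of `𝓢(X_∞)`, plus orbit continuity `horb`, into the (W-orb) letter of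
★ p863031 for EVERY `Ψ ∈ 𝓢(X_∞)`.  Density of the span of σ-products is ★ p863267 (`dense_span_symm_tensorPi`, LH4-p18 (g3)); `horb` is ★ p863364
(`continuous_archWeilRep_dD_expGL`, this seat).  THIS FILE supplies `A` and `hlaw` on the σ-products `𝒥⁻¹(Φ₁ ⊠ Φ₂)` FROM THE PRODUCT LAW of the small
pair's `ω_∞` along `t ↦ (exp tX, 1)` — the letter (C2-B) of LH4-p05 (g10), consumed BY VALUE:

  `hprod : ∀ t Φ₁ Φ₂, ω_∞(exp tX, 1) (𝒥⁻¹(Φ₁ ⊠ Φ₂)) = η t • 𝒥⁻¹((W t Φ₁) ⊠ Φ₂)`   (F-a + F-b + the curve identity, in any frame `𝒥`),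
  `hW : ∀ Φ₁ T₁, HasDerivAt (t ↦ T₁ (W t Φ₁)) (T₁ (D Φ₁)) 0`, `W 0 = id`            ((G2-W2) ★ `hasDerivAt_weilDatum_expMem_smul'` + the curve),
  `hη : HasDerivAt η η′ 0`, `η 0 = 1`                                                  (★ `contDiffAt_coe_etaD_placeSecJ_expMem` lineage).

The global operator is then EXPLICIT — `A := η′ • 1 + 𝒥⁻¹ ∘L (D ⊠̂ 1) ∘L 𝒥` with `⊠̂ =` ★ `SchwartzTensorOperators.tensorOp` (Hermite-matrix tensor product of
continuous operators, ★ `tensorOp_tensorPi : (A₁ ⊠̂ A₂)(f ⊠ g) = A₁ f ⊠ A₂ g`) — and the law on products is the weak product rule for `t ↦ η t • v t`.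

* §1 **`hasDerivAt_apply_smul_of_weak`** (abstract complex topological module `E`): if `η : ℝ → ℂ` has derivative `η′` at `0` and `v : ℝ → E` has WEAK
  derivative `v₀′` at `0` (against every continuous real-linear `T : E →L[ℝ] ℂ`), then `t ↦ T (η t • v t)` has derivative `T (η′ • v 0 + η 0 • v₀′)` at `0`
  (real and imaginary parts of `η`; `T ∘ (I • ·)` is again a real functional);
* §2 **`hasDerivAt_apply_of_productLaw`**, **`hlaw_products_of_productLaw`** (abstract `E` with a frame `𝒥 : E ≃L[ℂ] 𝓢(ℝ^{σ₁ ⊕ σ₂})`, ANY family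
  `U : ℝ → E → E`): the product law ⇒ `hlaw` on `P := {𝒥⁻¹(Φ₁ ⊠ Φ₂)}` with `A := η′ • 1 + 𝒥⁻¹ ∘L tensorOp D 1 ∘L 𝒥`;
* §3 **`thetaOrbitLetter_of_productLaw`** — THE (W-orb) LETTER OF ★ p863031 (`hWorb`, :267–282) at `N = 2`, for every `X ∈ 𝔲(J^𝔻)`, MODULO EXACTLY the
  product law `hprod` and the one-place derivative `hW` (+ `hη`): ★ p863327 ∘ ★ p863267 ∘ §2 ∘ ★ p863364.

No definition, no instance, no notation, no named-fact hypothesis, no `sorry`; axioms ⊆ {propext, Classical.choice, Quot.sound}.  HONEST LABEL: HC_CM is proved only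
modulo the 7 printed citations (2 remaining named inputs: hLiu418 = stmt-HodgeConjecture-24832, h413 = stmt-HodgeConjecture-24833) until rung 0 closes; this file is a
`--supports stmt-HodgeConjecture-24832` helper and moves no counter.

References: [Folland1989] G. B. Folland, *Harmonic Analysis in Phase Space* (1989), §1.7, §4.2 (4.24), Prop. (4.39); [ReedSimonI1980] M. Reed, B. Simon, *Methods of
Modern Mathematical Physics I*, Thm V.13; [Varadarajan1984] V. S. Varadarajan, *Lie Groups, Lie Algebras, and Their Representations*, Thm. 2.10.1.
-/

set_option autoImplicit false
set_option linter.dupNamespace false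

noncomputable section

open Filter Set Topology
open scoped SchwartzMap
open Literature.Analysis.SegalBargmann Literature.Analysis.Distribution

/-! ## §1 The weak product rule for `t ↦ η t • v t` against real functionals -/

namespace Summit.HodgeConjecture.HodgeConjecture.Cruxes.HLiu418.K2LiuArchOrbitLawOfProductLaw

section Weak

variable {E : Type*} [AddCommGroup E] [Module ℝ E] [Module ℂ E] [IsScalarTower ℝ ℂ E] [TopologicalSpace E] [ContinuousConstSMul ℂ E]

omit [ContinuousConstSMul ℂ E] in
/-- a real-linear functional on a complex module splits a complex scalar into real and imaginary parts:
`T (c • x) = c.re · T x + c.im · T (I • x)`. [folklore] -/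
theorem apply_complex_smul (T : E →L[ℝ] ℂ) (c : ℂ) (x : E) :
    T (c • x) = ((c.re : ℝ) : ℂ) * T x + ((c.im : ℝ) : ℂ) * T ((Complex.I : ℂ) • x) := by
  have hreal : ∀ (r : ℝ) (y : E), ((r : ℝ) : ℂ) • y = r • y := fun r y => by
    rw [← smul_one_smul ℂ r y, Complex.real_smul, mul_one]
  have hc : c • x = (c.re : ℝ) • x + (c.im : ℝ) • ((Complex.I : ℂ) • x) := by
    conv_lhs => rw [← Complex.re_add_im c]
    rw [add_smul, mul_smul, hreal, hreal]
  rw [hc, map_add, map_smul, map_smul, Complex.real_smul, Complex.real_smul]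

/-- **THE WEAK PRODUCT RULE**: if `η : ℝ → ℂ` is differentiable at `0` and `v : ℝ → E` is weakly differentiable at `0` (against every continuous
real-linear functional `T : E →L[ℝ] ℂ`, with weak derivative `v₀′`), then `t ↦ T (η t • v t)` is differentiable at `0` with derivative
`T (η′ • v 0 + η 0 • v₀′)`. [cite: Folland1989, §1.7] -/
theorem hasDerivAt_apply_smul_of_weak (η : ℝ → ℂ) {η' : ℂ} (hη : HasDerivAt η η' 0) (v : ℝ → E) {v₀' : E}
    (hv : ∀ T : E →L[ℝ] ℂ, HasDerivAt (fun t : ℝ => T (v t)) (T v₀') 0) (T : E →L[ℝ] ℂ) :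
    HasDerivAt (fun t : ℝ => T (η t • v t)) (T (η' • v 0 + η 0 • v₀')) 0 := by
  -- the functional `x ↦ T (I • x)` is again continuous and real-linear
  set TI : E →L[ℝ] ℂ := T.comp (((Complex.I : ℂ) • ContinuousLinearMap.id ℂ E).restrictScalars ℝ)
  have hTI_apply : ∀ x, TI x = T ((Complex.I : ℂ) • x) := fun x => rfl
  -- real and imaginary parts of `η`
  have hre : HasDerivAt (fun t : ℝ => (((η t).re : ℝ) : ℂ)) (((η'.re : ℝ) : ℂ)) 0 :=
    ((Complex.reCLM.hasFDerivAt.comp_hasDerivAt (0 : ℝ) hη)).ofReal_comp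
  have him : HasDerivAt (fun t : ℝ => (((η t).im : ℝ) : ℂ)) (((η'.im : ℝ) : ℂ)) 0 :=
    ((Complex.imCLM.hasFDerivAt.comp_hasDerivAt (0 : ℝ) hη)).ofReal_comp
  have h1 := hre.mul (hv T)
  have h2 := him.mul (hv TI)
  have hsum := h1.add h2
  have hfun : (fun t : ℝ => T (η t • v t)) =
      fun t : ℝ => (((η t).re : ℝ) : ℂ) * T (v t) + (((η t).im : ℝ) : ℂ) * TI (v t) := by
    funext t
    rw [apply_complex_smul, hTI_apply]
  have hsum' : HasDerivAt (fun t : ℝ => (((η t).re : ℝ) : ℂ) * T (v t) + (((η t).im : ℝ) : ℂ) * TI (v t))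
      ((((η'.re : ℝ) : ℂ)) * T (v 0) + (((η 0).re : ℝ) : ℂ) * T v₀' +
        ((((η'.im : ℝ) : ℂ)) * TI (v 0) + (((η 0).im : ℝ) : ℂ) * TI v₀')) 0 := hsum
  rw [hfun]
  refine hsum'.congr_deriv ?_
  rw [map_add, apply_complex_smul T η' (v 0), apply_complex_smul T (η 0) v₀', hTI_apply, hTI_apply]
  ring

end Weak

/-! ## §2 The orbit law on σ-products from the product law; the global operator `η′ • 1 + 𝒥⁻¹ ∘ (D ⊠̂ 1) ∘ 𝒥` -/

section Products

variable {E : Type*} [AddCommGroup E] [Module ℝ E] [Module ℂ E] [IsScalarTower ℝ ℂ E] [TopologicalSpace E] [ContinuousAdd E]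
  [ContinuousConstSMul ℂ E] {σ₁ σ₂ : Type*} [Fintype σ₁] [Fintype σ₂] [DecidableEq σ₁] [DecidableEq σ₂]
  (𝒥 : E ≃L[ℂ] SchwartzMap (σ₁ ⊕ σ₂ → ℝ) ℂ) (U : ℝ → E → E)
  (W : ℝ → SchwartzMap (σ₁ → ℝ) ℂ → SchwartzMap (σ₁ → ℝ) ℂ) (D : SchwartzMap (σ₁ → ℝ) ℂ →L[ℂ] SchwartzMap (σ₁ → ℝ) ℂ)
  (η : ℝ → ℂ) (η' : ℂ)

/-- **THE ORBIT LAW ON ONE σ-PRODUCT FROM THE PRODUCT LAW.**  Let `𝒥 : E ≃ 𝓢(ℝ^{σ₁ ⊕ σ₂})` be a frame, `U : ℝ → E → E` ANY family with the PRODUCT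
LAW `U t (𝒥⁻¹(Φ₁ ⊠ Φ₂)) = η t • 𝒥⁻¹((W t Φ₁) ⊠ Φ₂)`, where `W t` is weakly differentiable at `0` on every `Φ₁` with derivative `D Φ₁` (`D` continuous
ℂ-linear), `W 0 = id`, and `η` is differentiable at `0` with `η 0 = 1`.  Then along every continuous real-linear `T : E →L[ℝ] ℂ`,
`t ↦ T (U t (𝒥⁻¹(Φ₁ ⊠ Φ₂)))` has derivative `T (A (𝒥⁻¹(Φ₁ ⊠ Φ₂)))` at `0` for the GLOBAL operator `A := η′ • 1 + 𝒥⁻¹ ∘L (D ⊠̂ 1) ∘L 𝒥`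
(★ `tensorOp_tensorPi`). [cite: Folland1989, §1.7; (4.24), Prop. (4.39)] [cite: ReedSimonI1980, Thm V.13] -/
theorem hasDerivAt_apply_of_productLaw
    (hprod : ∀ (t : ℝ) (Φ₁ : SchwartzMap (σ₁ → ℝ) ℂ) (Φ₂ : SchwartzMap (σ₂ → ℝ) ℂ),
      U t (𝒥.symm (tensorPi Φ₁ Φ₂)) = η t • 𝒥.symm (tensorPi (W t Φ₁) Φ₂))
    (hW : ∀ (Φ₁ : SchwartzMap (σ₁ → ℝ) ℂ) (T₁ : SchwartzMap (σ₁ → ℝ) ℂ →L[ℝ] ℂ),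
      HasDerivAt (fun t : ℝ => T₁ (W t Φ₁)) (T₁ (D Φ₁)) 0)
    (hW0 : ∀ Φ₁ : SchwartzMap (σ₁ → ℝ) ℂ, W 0 Φ₁ = Φ₁) (hη : HasDerivAt η η' 0) (hη0 : η 0 = 1)
    (Φ₁ : SchwartzMap (σ₁ → ℝ) ℂ) (Φ₂ : SchwartzMap (σ₂ → ℝ) ℂ) (T : E →L[ℝ] ℂ) :
    HasDerivAt (fun t : ℝ => T (U t (𝒥.symm (tensorPi Φ₁ Φ₂))))
      (T ((η' • ContinuousLinearMap.id ℂ E +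
          (𝒥.symm : SchwartzMap (σ₁ ⊕ σ₂ → ℝ) ℂ →L[ℂ] E).comp
            ((tensorOp D (ContinuousLinearMap.id ℂ (SchwartzMap (σ₂ → ℝ) ℂ))).comp
              (𝒥 : E →L[ℂ] SchwartzMap (σ₁ ⊕ σ₂ → ℝ) ℂ)))
        (𝒥.symm (tensorPi Φ₁ Φ₂)))) 0 := by
  -- the weak derivative of `v t := 𝒥⁻¹((W t Φ₁) ⊠ Φ₂)` is `𝒥⁻¹((D Φ₁) ⊠ Φ₂)`: `Φ ↦ T (𝒥⁻¹(Φ ⊠ Φ₂))` is a real functional on `𝓢(ℝ^{σ₁})`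
  have hv : ∀ T' : E →L[ℝ] ℂ, HasDerivAt (fun t : ℝ => T' (𝒥.symm (tensorPi (W t Φ₁) Φ₂)))
      (T' (𝒥.symm (tensorPi (D Φ₁) Φ₂))) 0 := by
    intro T'
    set T₁ : SchwartzMap (σ₁ → ℝ) ℂ →L[ℝ] ℂ := T'.comp
      (((𝒥.symm : SchwartzMap (σ₁ ⊕ σ₂ → ℝ) ℂ →L[ℂ] E).restrictScalars ℝ).comp
        ((SchwartzMap.sumProdLeftCLM (𝕜 := ℂ) (E := ℝ) (ι₁ := σ₁) Φ₂).restrictScalars ℝ)) with hT₁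
    have hT₁_apply : ∀ Φ : SchwartzMap (σ₁ → ℝ) ℂ, T₁ Φ = T' (𝒥.symm (tensorPi Φ Φ₂)) := fun Φ => by
      simp only [hT₁, ContinuousLinearMap.comp_apply, ContinuousLinearMap.coe_restrictScalars',
        ContinuousLinearEquiv.coe_coe, sumProdLeftCLM_eq_tensorPi]
    have h := hW Φ₁ T₁
    simp only [hT₁_apply] at h
    exact h
  have hmain := hasDerivAt_apply_smul_of_weak η hη (fun t => 𝒥.symm (tensorPi (W t Φ₁) Φ₂)) hv T
  have hfun : (fun t : ℝ => T (U t (𝒥.symm (tensorPi Φ₁ Φ₂)))) =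
      fun t : ℝ => T (η t • 𝒥.symm (tensorPi (W t Φ₁) Φ₂)) := by
    funext t
    rw [hprod]
  rw [hfun]
  convert hmain using 2
  rw [hW0, hη0, one_smul, add_apply, smul_apply, ContinuousLinearMap.id_apply,
    ContinuousLinearMap.comp_apply, ContinuousLinearMap.comp_apply, ContinuousLinearEquiv.coe_coe, ContinuousLinearEquiv.coe_coe,
    ContinuousLinearEquiv.apply_symm_apply, tensorOp_tensorPi, ContinuousLinearMap.id_apply]

/-- **`hlaw` ON THE SET OF σ-PRODUCTS** (the binder shape of ★ p863327 `thetaOrbitLetter_of_dense_span` ∕ ★ p863267 `dense_span_symm_tensorPi`): under the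
product law, `∀ d ∈ {𝒥⁻¹(Φ₁ ⊠ Φ₂)}, ∀ T, HasDerivAt (t ↦ T (U t d)) (T (A d)) 0` with `A := η′ • 1 + 𝒥⁻¹ ∘L (D ⊠̂ 1) ∘L 𝒥`.
[cite: Folland1989, §1.7; (4.24), Prop. (4.39)] [cite: ReedSimonI1980, Thm V.13] -/
theorem hlaw_products_of_productLaw
    (hprod : ∀ (t : ℝ) (Φ₁ : SchwartzMap (σ₁ → ℝ) ℂ) (Φ₂ : SchwartzMap (σ₂ → ℝ) ℂ),
      U t (𝒥.symm (tensorPi Φ₁ Φ₂)) = η t • 𝒥.symm (tensorPi (W t Φ₁) Φ₂))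
    (hW : ∀ (Φ₁ : SchwartzMap (σ₁ → ℝ) ℂ) (T₁ : SchwartzMap (σ₁ → ℝ) ℂ →L[ℝ] ℂ),
      HasDerivAt (fun t : ℝ => T₁ (W t Φ₁)) (T₁ (D Φ₁)) 0)
    (hW0 : ∀ Φ₁ : SchwartzMap (σ₁ → ℝ) ℂ, W 0 Φ₁ = Φ₁) (hη : HasDerivAt η η' 0) (hη0 : η 0 = 1) :
    ∀ d ∈ {d : E | ∃ (f : SchwartzMap (σ₁ → ℝ) ℂ) (g : SchwartzMap (σ₂ → ℝ) ℂ), d = 𝒥.symm (tensorPi f g)},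
      ∀ T : E →L[ℝ] ℂ, HasDerivAt (fun t : ℝ => T (U t d))
        (T ((η' • ContinuousLinearMap.id ℂ E +
            (𝒥.symm : SchwartzMap (σ₁ ⊕ σ₂ → ℝ) ℂ →L[ℂ] E).comp
              ((tensorOp D (ContinuousLinearMap.id ℂ (SchwartzMap (σ₂ → ℝ) ℂ))).comp
                (𝒥 : E →L[ℂ] SchwartzMap (σ₁ ⊕ σ₂ → ℝ) ℂ))) d)) 0 := by
  rintro d ⟨f, g, rfl⟩ T
  exact hasDerivAt_apply_of_productLaw 𝒥 U W D η η' hprod hW hW0 hη hη0 f g T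

end Products

end Summit.HodgeConjecture.HodgeConjecture.Cruxes.HLiu418.K2LiuArchOrbitLawOfProductLaw

/-! ## §3 The (W-orb) letter of ★ p863031 at `N = 2`, modulo the product law -/

namespace Summit.HodgeConjecture.HodgeConjecture.Cruxes.HLiu418.K2LiuArchOrbitLawOfProductLaw

open NumberField NumberField.mixedEmbedding MeasureTheory IsDedekindDomain
open scoped Matrix TensorProduct Classical
open Literature.NumberTheory.Automorphic Literature.NumberTheory.Automorphic.UnitaryGroup
open Literature.NumberTheory.Automorphic.IdeleClassGroup
open Literature.NumberTheory.Automorphic.Liu2021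
open Literature.NumberTheory.Automorphic.Liu2021.Def411WeilCarriers
open Literature.NumberTheory.Automorphic.Liu2021.Def411WeilCarriersDoubling
open Literature.NumberTheory.GelbartRogawski1991 Literature.NumberTheory.GelbartRogawski1991.UnitaryDualPair
open Literature.NumberTheory.GelbartRogawski1991.GRConstruction
open Literature.NumberTheory.GaloisRepresentations
open Literature.NumberTheory.Weil1964
open Literature.RepresentationTheory.Liu2021
open Literature.RepresentationTheory.HeisenbergGroup
open Literature.NumberTheory.K2Lit.DoubledLineTheta Literature.NumberTheory.K2Lit.SiegelDoubled
open Summit.HodgeConjecture.HodgeConjecture.Cruxes.HLiu418.K2LiuFaceGThetaLetter (proj_chiSplittingLine_eq_toSp archSkew_diagonal_of_hermD)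
open Summit.HodgeConjecture.HodgeConjecture.Cruxes.HLiu418.K2LiuArchOrbitDerivClosure (thetaOrbitLetter_of_dense_span)
open Summit.HodgeConjecture.HodgeConjecture.Cruxes.HLiu418.K2LiuArchSchwartzPlaceProductDense (dense_span_symm_tensorPi)
open Summit.HodgeConjecture.HodgeConjecture.Cruxes.HLiu418.K2LiuArchWeilOrbitContinuous (continuous_archWeilRep_dD_expGL)
open HodgeCM.Model.HypCensus (archWeilRep)

variable (L : Type) [Field L] [NumberField L] [IsCMField L]
variable {n : ℕ} (e : Fin 2 × Fin 1 ≃ Fin n)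
  (dV : Fin 2 → L) (hdV : ∀ i, IsCMField.complexConj L (dV i) = dV i)
  (dW : Fin 1 → L) (hdW : ∀ i, IsCMField.complexConj L (dW i) = dW i)
  {n'' : ℕ} (e₁ : Fin (n + n) × Fin 1 ≃ Fin n'')
  (hdV0 : ∀ i, dV i ≠ 0) (hdW0 : ∀ i, dW i ≠ 0)
  (lam : IdeleClassGroup L →ₜ* Circle) (hlam : IsConjugateSymplectic L lam) (a' : (Fp L)ˣ)

/-- **THE (W-orb) LETTER OF ★ p863031 MODULO THE PRODUCT LAW** (rank profile `N = 2` of the #42F′ frame, every `X ∈ 𝔲(J^𝔻)`).  Fix a frame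
`𝒥 : 𝓢(X_∞) ≃L[ℂ] 𝓢(ℝ^{σ₁ ⊕ σ₂})` (the variables of one place `σ` against the rest).  SUPPOSE the small pair's `ω_∞` along `t ↦ (exp tX, 1)` satisfies the
PRODUCT LAW `ω_∞(exp tX, 1) (𝒥⁻¹(Φ₁ ⊠ Φ₂)) = η t • 𝒥⁻¹((W t Φ₁) ⊠ Φ₂)` (the letter (C2-B): F-a + F-b + the curve identity), with `W t` weakly differentiable at
`0` on every `Φ₁` with derivative `D Φ₁` for one continuous ℂ-linear `D` ((G2-W2) ★ `hasDerivAt_weilDatum_expMem_smul'`), `W 0 = id`, `HasDerivAt η η′ 0`,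
`η 0 = 1`.  THEN every `𝓢(X_∞)`-orbit map of `ω_∞` is differentiable at `t = 0` along `t ↦ (exp tX, 1)` against every continuous real-linear functional, with
derivative some `Ψ∞′ ∈ 𝓢(X_∞)` — the `hWorb` binder of ★ p863031 `faceG_thetaLetter_of_archOrbitDeriv'` VERBATIM: ★ p863327 `thetaOrbitLetter_of_dense_span` at
`P :=` the σ-products (dense span: ★ p863267 `dense_span_symm_tensorPi`), `A := η′ • 1 + 𝒥⁻¹ ∘L (D ⊠̂ 1) ∘L 𝒥` (§2), `horb :=` ★ p863364
`continuous_archWeilRep_dD_expGL`. [cite: Folland1989, §1.7; §4.2 (4.24), Prop. (4.39)] [cite: ReedSimonI1980, Thm V.13] [cite: Varadarajan1984, Thm. 2.10.1] -/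
theorem thetaOrbitLetter_of_productLaw {X : Matrix (Fin (n + n)) (Fin (n + n)) (mixedSpace L)}
    (hX : X ∈ archSkew (Fp L) L (IsCMField.complexConj L) (n + n) (hermD L e dV hdV dW hdW))
    {σ₁ σ₂ : Type*} [Fintype σ₁] [Fintype σ₂] [DecidableEq σ₁] [DecidableEq σ₂]
    (𝒥 : 𝓢((Fin n'' → mixedSpace (Fp L)), ℂ) ≃L[ℂ] SchwartzMap (σ₁ ⊕ σ₂ → ℝ) ℂ)
    (W : ℝ → SchwartzMap (σ₁ → ℝ) ℂ → SchwartzMap (σ₁ → ℝ) ℂ) (D : SchwartzMap (σ₁ → ℝ) ℂ →L[ℂ] SchwartzMap (σ₁ → ℝ) ℂ)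
    (η : ℝ → ℂ) (η' : ℂ)
    (hprod : ∀ (t : ℝ) (Φ₁ : SchwartzMap (σ₁ → ℝ) ℂ) (Φ₂ : SchwartzMap (σ₂ → ℝ) ℂ),
      archWeilRep (Fp L) L (IsCMField.complexConj L) (n + n) 1 (Matrix.diagonal (dD L e dV hdV dW hdW)) (JW (Fp L) L a')
          (complexConj_imagUnit L) (imagUnit_ne_zero L) (imagUnit_mul_self L)
          (realDiagonal_isSymm L (dD L e dV hdV dW hdW) (dD_conj L e dV hdV dW hdW)) (isSymm_TW (Fp L) a')
          (isUnit_det_realDiagonal L (dD L e dV hdV dW hdW) (dD_conj L e dV hdV dW hdW) (dD_ne_zero L e dV hdV dW hdW hdV0 hdW0))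
          (isUnit_det_TW (Fp L) a') (realDiagonal_map L (dD L e dV hdV dW hdW) (dD_conj L e dV hdV dW hdW)).symm (JW_eq (Fp L) L a') e₁
          (chiSplittingLine L e₁ (dD L e dV hdV dW hdW) (dD_conj L e dV hdV dW hdW) (dD_ne_zero L e dV hdV dW hdW hdV0 hdW0)
            (toHeckeCharacter L lam) (isUnitary_toHeckeCharacter L lam)
            ((isOscillatorChar_toHeckeCharacter_iff lam).mpr hlam) (TW (Fp L) a')
            (isUnit_det_TW (Fp L) a') (JW (Fp L) L a') (JW_eq (Fp L) L a'))
          (proj_chiSplittingLine_eq_toSp L e dV hdV dW hdW e₁ hdV0 hdW0 lam hlam a')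
          (⟨expGL (t • X), expGL_smul_mem_arch (Matrix.diagonal (dD L e dV hdV dW hdW)) (archSkew_diagonal_of_hermD L e dV hdV dW hdW hX) t⟩, 1)
          (𝒥.symm (tensorPi Φ₁ Φ₂)) =
        η t • 𝒥.symm (tensorPi (W t Φ₁) Φ₂))
    (hW : ∀ (Φ₁ : SchwartzMap (σ₁ → ℝ) ℂ) (T₁ : SchwartzMap (σ₁ → ℝ) ℂ →L[ℝ] ℂ),
      HasDerivAt (fun t : ℝ => T₁ (W t Φ₁)) (T₁ (D Φ₁)) 0)
    (hW0 : ∀ Φ₁ : SchwartzMap (σ₁ → ℝ) ℂ, W 0 Φ₁ = Φ₁) (hη : HasDerivAt η η' 0) (hη0 : η 0 = 1) :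
    ∀ Ψinf : 𝓢((Fin n'' → mixedSpace (Fp L)), ℂ), ∃ Ψinf' : 𝓢((Fin n'' → mixedSpace (Fp L)), ℂ),
      ∀ T : 𝓢((Fin n'' → mixedSpace (Fp L)), ℂ) →L[ℝ] ℂ,
      HasDerivAt (fun t : ℝ => T
        (archWeilRep (Fp L) L (IsCMField.complexConj L) (n + n) 1 (Matrix.diagonal (dD L e dV hdV dW hdW)) (JW (Fp L) L a')
            (complexConj_imagUnit L) (imagUnit_ne_zero L) (imagUnit_mul_self L)
            (realDiagonal_isSymm L (dD L e dV hdV dW hdW) (dD_conj L e dV hdV dW hdW)) (isSymm_TW (Fp L) a')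
            (isUnit_det_realDiagonal L (dD L e dV hdV dW hdW) (dD_conj L e dV hdV dW hdW) (dD_ne_zero L e dV hdV dW hdW hdV0 hdW0))
            (isUnit_det_TW (Fp L) a') (realDiagonal_map L (dD L e dV hdV dW hdW) (dD_conj L e dV hdV dW hdW)).symm (JW_eq (Fp L) L a') e₁
            (chiSplittingLine L e₁ (dD L e dV hdV dW hdW) (dD_conj L e dV hdV dW hdW) (dD_ne_zero L e dV hdV dW hdW hdV0 hdW0)
              (toHeckeCharacter L lam) (isUnitary_toHeckeCharacter L lam)
              ((isOscillatorChar_toHeckeCharacter_iff lam).mpr hlam) (TW (Fp L) a')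
              (isUnit_det_TW (Fp L) a') (JW (Fp L) L a') (JW_eq (Fp L) L a'))
            (proj_chiSplittingLine_eq_toSp L e dV hdV dW hdW e₁ hdV0 hdW0 lam hlam a')
            (⟨expGL (t • X), expGL_smul_mem_arch (Matrix.diagonal (dD L e dV hdV dW hdW)) (archSkew_diagonal_of_hermD L e dV hdV dW hdW hX) t⟩, 1)
            Ψinf))
        (T Ψinf') 0 :=
  thetaOrbitLetter_of_dense_span L e dV hdV dW hdW e₁ hdV0 hdW0 lam hlam a' hX
    {d | ∃ (f : SchwartzMap (σ₁ → ℝ) ℂ) (g : SchwartzMap (σ₂ → ℝ) ℂ), d = 𝒥.symm (tensorPi f g)}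
    (dense_span_symm_tensorPi 𝒥) _
    (hlaw_products_of_productLaw 𝒥
      (fun (t : ℝ) (d : 𝓢((Fin n'' → mixedSpace (Fp L)), ℂ)) =>
        archWeilRep (Fp L) L (IsCMField.complexConj L) (n + n) 1 (Matrix.diagonal (dD L e dV hdV dW hdW)) (JW (Fp L) L a')
          (complexConj_imagUnit L) (imagUnit_ne_zero L) (imagUnit_mul_self L)
          (realDiagonal_isSymm L (dD L e dV hdV dW hdW) (dD_conj L e dV hdV dW hdW)) (isSymm_TW (Fp L) a')
          (isUnit_det_realDiagonal L (dD L e dV hdV dW hdW) (dD_conj L e dV hdV dW hdW) (dD_ne_zero L e dV hdV dW hdW hdV0 hdW0))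
          (isUnit_det_TW (Fp L) a') (realDiagonal_map L (dD L e dV hdV dW hdW) (dD_conj L e dV hdV dW hdW)).symm (JW_eq (Fp L) L a') e₁
          (chiSplittingLine L e₁ (dD L e dV hdV dW hdW) (dD_conj L e dV hdV dW hdW) (dD_ne_zero L e dV hdV dW hdW hdV0 hdW0)
            (toHeckeCharacter L lam) (isUnitary_toHeckeCharacter L lam)
            ((isOscillatorChar_toHeckeCharacter_iff lam).mpr hlam) (TW (Fp L) a')
            (isUnit_det_TW (Fp L) a') (JW (Fp L) L a') (JW_eq (Fp L) L a'))
          (proj_chiSplittingLine_eq_toSp L e dV hdV dW hdW e₁ hdV0 hdW0 lam hlam a')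
          (⟨expGL (t • X), expGL_smul_mem_arch (Matrix.diagonal (dD L e dV hdV dW hdW)) (archSkew_diagonal_of_hermD L e dV hdV dW hdW hX) t⟩, 1)
          d)
      W D η η' hprod hW hW0 hη hη0)
    (fun Ψ => continuous_archWeilRep_dD_expGL L e dV hdV dW hdW e₁ hdV0 hdW0 lam hlam a' hX Ψ)

end Summit.HodgeConjecture.HodgeConjecture.Cruxes.HLiu418.K2LiuArchOrbitLawOfProductLaw

end
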